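import Summits.BirchSwinnertonDyer.BirchSwinnertonDyer.Theorems.CMKolyvaginAtInertTwoCMKolyvaginConjectureAtInertTwoFirstDescentDepthBound
import Literature.NumberTheory.EllipticCurves.KolyvaginShaStructureIndexFormProofs
import Literature.NumberTheory.EllipticCurves.MordellWeilTheoremProofs
import HarnessLib

/-!
# Route `CMKolyvaginAtInertTwo`, crux `CMKolyvaginConjectureAtInertTwo` (stmt-BirchSwinnertonDyer-24648),
# stub `stub_positiveDepth` — THE DEPTH DOES NOT GROW ALONG SQUARE-FREE PRODUCTS OF DEEP CM-INERT PRIMES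
# (`m_r ≤ m_0` for every `r`, Kolyvagin's monotonicity at `p = 2` on H₂), ALSO IN THE STUB'S OWN CURRENCY

Seat `leafhand-bsd-cmkolyvaginatinert-5` g0 (cell `bsd-eis`); helper `--supports stmt-BirchSwinnertonDyer-24648`.
THEOREMS ONLY: no definition, no named fact, no `sorry`.  BSD is NOT proved by any of this; the stub and the crux
stay OPEN.  Conditional (like the route's lower-bound engine) on Gross 1991 Prop. 3.7 (2) BY NAME
(`GrossLMS1991.prop37_2_reductionCongruence_inert N_E W K`, item 28665).

WHAT.  Iterating the prime step of `…FirstDescentDepthBound` (`exists_deep_cmInert_prime_depth_le`): on an H₂ frame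
with a conductor-`1` datum of exact depth `M₀` and `L ≥ M₀ + 1`, for EVERY `r` there are a square-free `n` with exactly
`r` prime factors — each a Zhang–Kolyvagin prime at `2` of index `≥ L`, with `Frob = Frob_∞` on `K(E[2^L])` and inert in
the CM field — and a datum `e` of conductor `n` with `2^{L−M₀−1}·c_L(n) ≠ 0`, hence **`2^{M₀+1} ∤ P(n)` in `E(K[n])`**
(`exists_squarefree_card_depth_le`).  So along these Kolyvagin products the `2`-divisibility depth of the derived
Heegner point never exceeds the depth `M₀` of `y_K`: Kolyvagin's `m_r ≤ m_0` (McCallum 1991 §5) at `p = 2` on the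
CM-inert habitat.  The inductive step (`exists_deep_mul_depth_le`) is McCallum's proof of Prop. 5.2 verbatim at level
`2^L`: the class `c_L(n)` has some exact order `2^k` with `k ≥ L − M₀`, is a `τ`-eigenclass
(`KolyvaginClassSign.sign_conjAct_kolyvaginClass_two`), the full-order pair Čebotarev on H₂
(`KolyvaginImageTwo.infinite_kolyvaginPrime_localization_fullOrder_pair_of_cmInert`) supplies a new deep CM-inert
prime `ℓ` where its localisation keeps order `2^k`, and Kolyvagin's relation at `2`
(`KolyvaginLowerTwo.kolyvaginRelationAtTwo_at_of_prop37_2`) on compatible data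
(`JET.exists_compatible_data_of_grossCM`) transports this to `c_L(nℓ)`.
§2 reads this in the STUB'S OWN CURRENCY: the registered `stub_positiveDepth` carries, after the habitat and frame
binders, exactly `¬ IsOfFinAddOrder d₁.derivedPoint` (`y_K` of infinite order) and `∃ Q, 2 • Q = d₁.derivedPoint`
(positive depth); Mordell–Weil over the number field `K[1]` (`module_finite_point_holds`, `numberField_ringClassField`,
`exists_pow_smul_eq_and_not_of_not_isOfFinAddOrder`) turns these into an EXACT depth `M₀ ≥ 1` (`exists_exactDepth_pos`),
whence `exists_exactDepth_and_deep_cmInert_prime` (prime level) and `exists_exactDepth_and_squarefree_card` (every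
number `r` of prime factors): the stub's hypotheses in, Kolyvagin's `m_r ≤ m_0 = M₀` out.
What the stub still asks: a level with depth ZERO (`M_∞ = 0`) — research at `p = 2`.

References: [Kolyvagin1991MathAnn] Thm. 2.2; [McCallumLMS1991] §3 Cor. 3.2, §4 Prop. 4.4, Cor. 4.5, §5 (m_r, ord_p,
proof of Prop. 5.2); [GrossLMS1991] Prop. 3.6, Prop. 3.7 (2), Lemma 4.3; [SilvermanAEC2009] Thm. VIII.6.7 (Mordell–Weil).
-/

set_option autoImplicit false
-- the Theorems namespace of this sub repeats the summit name by design (D-0017 nested layout)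
set_option linter.dupNamespace false

noncomputable section

open scoped Classical

open Field NumberField IsDedekindDomain Function WeierstrassCurve Rat.HeightOneSpectrum
open Literature.NumberTheory.EllipticCurves
open Literature.NumberTheory.EllipticCurves.ModularForms
open Literature.NumberTheory.GaloisRepresentations
open Literature.NumberTheory.GaloisCohomology
open Literature.NumberTheory.EllipticCurves.GrossLMS1991 (prop37_2_reductionCongruence_inert)
open Summit.BirchSwinnertonDyer.Rank1Residual (X11b.KolyvaginAssembly.discr_lt_neg_four JET.exists_compatible_data_of_grossCM)
open Summit.BirchSwinnertonDyer.BirchSwinnertonDyer.Theorems.GenusExact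
open Summit.BirchSwinnertonDyer.BirchSwinnertonDyer.Theorems.GenusExact.VisiblePairAtTwo (exists_natCast_mem)

namespace Summit.BirchSwinnertonDyer.BirchSwinnertonDyer.Theorems.CMKolyvaginFirstDescentTwo

variable (W : WeierstrassCurve ℚ) [W.IsElliptic] [W.IsGloballyMinimal] [NeZero (W.conductorNorm ℤ)]
  {K : Type} [Field K] [NumberField K]

omit [W.IsElliptic] [W.IsGloballyMinimal] in
/-- **From `2^{L−M₀−1}·c_L(n) ≠ 0` to `2^{M₀+1} ∤ P(n)`** (the easy half of McCallum's Cor. 4.5 at `2`, any level; the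
junk branch of `kolyvaginClass` is excluded by the non-vanishing itself). [cite: McCallumLMS1991, §4 Cor. 4.5] -/
theorem not_pow_dvd_derivedPoint_of_zsmul_kolyvaginClass_ne_zero
    {Dt : ModularParametrizationData W (W.conductorNorm ℤ)} {β : ℤ} {ι : K →+* ℂ} {n : ℕ}
    (e : KolyvaginHeegnerData Dt β ι n) {L M₀ : ℕ} (hL : M₀ + 1 ≤ L)
    (hne : ((2 ^ (L - M₀ - 1) : ℕ) : ℤ) • e.kolyvaginClass Nat.prime_two L ≠ 0) :
    ¬ ∃ Q : (W.baseChange (ringClassField K ι n)).toAffine.Point,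
      ((2 ^ (M₀ + 1) : ℕ) : ℤ) • Q = e.derivedPoint := by
  rintro ⟨Q, hQ'⟩
  have hne0 : e.kolyvaginClass Nat.prime_two L ≠ 0 := fun h0 ↦ hne (by rw [h0]; exact zsmul_zero _)
  obtain ⟨hA', hP'⟩ := e.kolyvaginClass_ne_zero hne0
  apply hne
  rw [Rank1Residual.JET.zsmul_kolyvaginClass_eq_zero_iff e Nat.prime_two L hA' hP']
  refine ⟨Q, ?_⟩
  rw [← hQ', smul_smul, ← Nat.cast_mul, ← pow_add]
  have hLeq : L - M₀ - 1 + (M₀ + 1) = L := by omega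
  rw [hLeq]

/-- **The inductive step: append a deep CM-inert prime keeping `2^{L−M₀−1}·c_L ≠ 0`.**  H₂ frame with Gross 1991
Prop. 3.7 (2) by name; `L ≥ M₀ + 1`, `1 ≤ L`; `n` square-free, all of whose primes are Zhang–Kolyvagin at `2` of index
`≥ L`; a datum `e` of conductor `n` with `2^{L−M₀−1}·c_L(e) ≠ 0`; a finite `S`.  THEN there are a prime `ℓ ∉ S`,
`ℓ ∤ n`, Zhang–Kolyvagin at `2` of index `≥ L` with `Frob_ℓ = Frob_∞` on `K(E[2^L])` and `CMInert W ℓ`, and a datum `e'`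
of conductor `n·ℓ` with `2^{L−M₀−1}·c_L(e') ≠ 0`.  McCallum's proof of Prop. 5.2 at level `2^L` on H₂ (the route's
`KolyvaginLowerTwo.exists_deep_mul_primitive` with «full order `4`» replaced by «order `≥ 2^{L−M₀}`»).
[cite: McCallumLMS1991, §5 proof of Prop. 5.2; §4 Prop. 4.4; §3 Cor. 3.2] [cite: GrossLMS1991, Prop. 3.7 (2)] -/
theorem exists_deep_mul_depth_le (hCM : W.HasCM) (hin : Rank1Residual.CMInert W 2)
    (hρ2 : W.HasSurjectiveModNGaloisRep 2)
    (hK : IsImaginaryQuadratic K) (hodd : Odd (NumberField.discr K)) (h3 : NumberField.discr K ≠ -3)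
    (hHe : SatisfiesHeegnerHypothesis (W.conductorNorm ℤ) K)
    (h37 : prop37_2_reductionCongruence_inert (W.conductorNorm ℤ) W K)
    (Dt : ModularParametrizationData W (W.conductorNorm ℤ)) (β : ℤ) (ι : K →+* ℂ) {M₀ L : ℕ} (hL : M₀ + 1 ≤ L)
    {n : ℕ} (hn : Squarefree n)
    (hnK : ∀ q ∈ n.primeFactors,
      Zhang2014.IsKolyvaginPrime (W.conductorNorm ℤ) W K 2 q ∧ L ≤ Zhang2014.kolyvaginIndex W 2 q)
    (e : KolyvaginHeegnerData Dt β ι n)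
    (he : ((2 ^ (L - M₀ - 1) : ℕ) : ℤ) • e.kolyvaginClass Nat.prime_two L ≠ 0) (S : Finset ℕ) :
    ∃ (ℓ : ℕ) (e' : KolyvaginHeegnerData Dt β ι (n * ℓ)), ℓ.Prime ∧ ℓ ∉ S ∧ ℓ ∉ n.primeFactors ∧
      Zhang2014.IsKolyvaginPrime (W.conductorNorm ℤ) W K 2 ℓ ∧ L ≤ Zhang2014.kolyvaginIndex W 2 ℓ ∧
      FrobEqFrobInfty W K (2 ^ L) ℓ ∧ Rank1Residual.CMInert W ℓ ∧
      ((2 ^ (L - M₀ - 1) : ℕ) : ℤ) • e'.kolyvaginClass Nat.prime_two L ≠ 0 := by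
  haveI : Fact (Nat.Prime 2) := ⟨Nat.prime_two⟩
  have hn0 : n ≠ 0 := hn.ne_zero
  have h2K : Module.finrank ℚ K = 2 := hK.1
  have h4 : NumberField.discr K ≠ -4 := fun h ↦ by
    rw [h] at hodd
    exact (Int.not_even_iff_odd.mpr hodd) ⟨-2, by norm_num⟩
  have hD : NumberField.discr K < -4 := X11b.KolyvaginAssembly.discr_lt_neg_four hK ⟨h3, h4⟩
  have hsurj1 : W.HasSurjectiveModNGaloisRep ((2 : ℤ) ^ 1) := by simpa using hρ2
  have hL1 : 1 ≤ L := by omega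
  obtain ⟨τ, -, hτ, -⟩ := PlusDescent.exists_gal_ne_one_sqrt_discr (K := K) h2K
  -- ### the class `X = c_L(e)` has exact order `2^k` with `L − M₀ ≤ k`
  set X := e.kolyvaginClass Nat.prime_two L with hX_def
  have hXL : ((2 ^ L : ℕ) : ℤ) • X = 0 := zsmul_discreteH1_torsion _ _
  have hdvd : addOrderOf X ∣ 2 ^ L := by
    rw [addOrderOf_dvd_iff_nsmul_eq_zero, ← natCast_zsmul]
    exact hXL
  obtain ⟨k, hkL, hk⟩ := (Nat.dvd_prime_pow Nat.prime_two).mp hdvd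
  have hkm : L - M₀ ≤ k := by
    by_contra hlt
    apply he
    have hle : k ≤ L - M₀ - 1 := by omega
    obtain ⟨c, hc⟩ := Nat.exists_eq_add_of_le hle
    rw [hc, pow_add, Nat.cast_mul, mul_comm, mul_smul, natCast_zsmul X (2 ^ k), ← hk, addOrderOf_nsmul_eq_zero]
    exact zsmul_zero _
  have hk1 : 1 ≤ k := by omega
  -- ### `X` is a `τ`-eigenclass
  obtain ⟨hsgn, hτX⟩ := KolyvaginClassSign.sign_conjAct_kolyvaginClass_two hK h3 h4 hodd hHe hsurj1 τ hτ Dt β ι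
    hn hL1 hnK e
  -- ### the full-order pair Čebotarev on H₂ (pair `(X, X)`), with `CMInert W ℓ`
  have hinf := KolyvaginImageTwo.infinite_kolyvaginPrime_localization_fullOrder_pair_of_cmInert W K hCM hin hρ2
    hK hHe τ hτ L hL1 X X hk1 hk1 hk hk hsgn hsgn hτX hτX
  obtain ⟨ℓ, hℓmem, hℓS⟩ := hinf.exists_notMem_finset (S ∪ n.primeFactors)
  obtain ⟨hFrob, hKol, hidx, hF, hloc⟩ := hℓmem
  rw [Finset.notMem_union] at hℓS
  obtain ⟨hℓS, hℓn⟩ := hℓS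
  have hℓp : ℓ.Prime := hKol.1
  have hℓdvd : ¬ ℓ ∣ n := fun h ↦ hℓn (Nat.mem_primeFactors.mpr ⟨hℓp, h, hn0⟩)
  have hsq : Squarefree (n * ℓ) :=
    (Nat.squarefree_mul ((Nat.Prime.coprime_iff_not_dvd hℓp).mpr hℓdvd).symm).mpr ⟨hn, hℓp.squarefree⟩
  have hall : ∀ q ∈ (n * ℓ).primeFactors,
      Zhang2014.IsKolyvaginPrime (W.conductorNorm ℤ) W K 2 q ∧ L ≤ Zhang2014.kolyvaginIndex W 2 q := by
    intro q hq
    rw [Nat.primeFactors_mul hn0 hℓp.ne_zero, Finset.mem_union] at hq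
    rcases hq with hq | hq
    · exact hnK q hq
    · rw [hℓp.primeFactors, Finset.mem_singleton] at hq
      subst hq
      exact ⟨hKol, hidx⟩
  -- ### a compatible datum at conductor `n * ℓ`
  obtain ⟨dℓ, hdℓ⟩ := JET.exists_compatible_data_of_grossCM
    (phi_heegnerPointOfConductor_mem_range_map_ringClassField_holds (W.conductorNorm ℤ) W K) hK hD hHe 2 Dt β ι hn
    (fun q hq ↦ (hnK q hq).1) e
  obtain ⟨hσc, hS, hS', hemb⟩ := hdℓ ℓ hKol hℓn
  set e' := dℓ ℓ hKol hℓn with he'_def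
  obtain ⟨v, hv⟩ := exists_natCast_mem (K := K) hℓp
  -- ### Kolyvagin's relation at `2` transports the local order of `X` at `λ ∣ ℓ` to `c_L(e')`
  have hQ := KolyvaginLowerTwo.kolyvaginRelationAtTwo_at_of_prop37_2 W Dt β ι hρ2 hK h3 h4 hHe h37 L hsq hℓp hℓdvd
    hall e e' hσc hS hS' hemb v hv (k - 1)
  have hXloc : ¬ ((2 ^ (k - 1) : ℕ) : ℤ) • X ∈
      (W.baseChange K).torsionLocalKer (v.adicCompletion K) ((2 ^ L : ℕ) : ℤ) := by
    intro h
    have := ((hloc v hv).1 (k - 1)).mp h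
    omega
  have hne : ((2 ^ (k - 1) : ℕ) : ℤ) • e'.kolyvaginClass Nat.prime_two L ≠ 0 := by
    intro h0
    apply hXloc
    exact hQ.2.mp (by rw [h0]; exact AddSubgroup.zero_mem _)
  -- ### `2^{k−1}·c ≠ 0` with `L − M₀ − 1 ≤ k − 1` gives `2^{L−M₀−1}·c ≠ 0`
  have hne' : ((2 ^ (L - M₀ - 1) : ℕ) : ℤ) • e'.kolyvaginClass Nat.prime_two L ≠ 0 := by
    intro h0
    apply hne
    obtain ⟨c, hc⟩ := Nat.exists_eq_add_of_le (show L - M₀ - 1 ≤ k - 1 by omega)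
    rw [hc, pow_add, Nat.cast_mul, mul_comm, mul_smul, h0]
    exact zsmul_zero _
  exact ⟨ℓ, e', hℓp, hℓS, hℓn, hKol, hidx, hFrob, hF, hne'⟩

/-- **THE DEPTH DOES NOT GROW ALONG SQUARE-FREE PRODUCTS OF DEEP CM-INERT KOLYVAGIN PRIMES (`m_r ≤ m_0`).**  On an H₂
frame (`W` globally minimal with CM, `2` inert in the CM field, `ρ̄_{E,2}` onto; `K` imaginary quadratic, odd `d_K ≠ −3`,
Heegner; Gross 1991 Prop. 3.7 (2) at `(W, K)` by name) with a conductor-`1` datum `d₁` of exact depth `M₀`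
(`2^{M₀} ∥ P(1)` in `E(K[1])`) and `L ≥ M₀ + 1`: for every `r` there are a square-free `n` with EXACTLY `r` prime factors,
each a Zhang–Kolyvagin prime at `2` of index `≥ L` with `Frob = Frob_∞` on `K(E[2^L])` and inert in the CM field, and a
datum `e` of conductor `n` with `2^{L−M₀−1}·c_L(e) ≠ 0` and `2^{M₀+1} ∤ P(n)` in `E(K[n])`.  Kolyvagin's monotonicity
`m_r ≤ m_0` (McCallum 1991 §5) at `p = 2` on the CM-inert habitat.
[cite: McCallumLMS1991, §5 (m_r; proof of Prop. 5.2)] [cite: Kolyvagin1991MathAnn, Thm. 2.2] [cite: GrossLMS1991, Prop. 3.7 (2)] -/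
theorem exists_squarefree_card_depth_le (hCM : W.HasCM) (hin : Rank1Residual.CMInert W 2)
    (hρ2 : W.HasSurjectiveModNGaloisRep 2)
    (hK : IsImaginaryQuadratic K) (hodd : Odd (NumberField.discr K)) (h3 : NumberField.discr K ≠ -3)
    (hHe : SatisfiesHeegnerHypothesis (W.conductorNorm ℤ) K)
    (h37 : prop37_2_reductionCongruence_inert (W.conductorNorm ℤ) W K)
    (Dt : ModularParametrizationData W (W.conductorNorm ℤ)) (β : ℤ) (ι : K →+* ℂ)
    (d₁ : KolyvaginHeegnerData Dt β ι 1) {M₀ : ℕ}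
    (hdiv : ∃ Q : (W.baseChange (ringClassField K ι 1)).toAffine.Point,
      ((2 ^ M₀ : ℕ) : ℤ) • Q = d₁.derivedPoint)
    (hndiv : ¬ ∃ Q : (W.baseChange (ringClassField K ι 1)).toAffine.Point,
      ((2 ^ (M₀ + 1) : ℕ) : ℤ) • Q = d₁.derivedPoint)
    {L : ℕ} (hL : M₀ + 1 ≤ L) (r : ℕ) :
    ∃ (n : ℕ) (e : KolyvaginHeegnerData Dt β ι n), Squarefree n ∧ n.primeFactors.card = r ∧
      (∀ q ∈ n.primeFactors, Zhang2014.IsKolyvaginPrime (W.conductorNorm ℤ) W K 2 q ∧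
        L ≤ Zhang2014.kolyvaginIndex W 2 q ∧ FrobEqFrobInfty W K (2 ^ L) q ∧ Rank1Residual.CMInert W q) ∧
      ((2 ^ (L - M₀ - 1) : ℕ) : ℤ) • e.kolyvaginClass Nat.prime_two L ≠ 0 ∧
      ¬ ∃ Q : (W.baseChange (ringClassField K ι n)).toAffine.Point,
        ((2 ^ (M₀ + 1) : ℕ) : ℤ) • Q = e.derivedPoint := by
  haveI : Fact (Nat.Prime 2) := ⟨Nat.prime_two⟩
  -- it suffices to carry `2^{L−M₀−1}·c_L ≠ 0`
  suffices h : ∃ (n : ℕ) (e : KolyvaginHeegnerData Dt β ι n), Squarefree n ∧ n.primeFactors.card = r ∧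
      (∀ q ∈ n.primeFactors, Zhang2014.IsKolyvaginPrime (W.conductorNorm ℤ) W K 2 q ∧
        L ≤ Zhang2014.kolyvaginIndex W 2 q ∧ FrobEqFrobInfty W K (2 ^ L) q ∧ Rank1Residual.CMInert W q) ∧
      ((2 ^ (L - M₀ - 1) : ℕ) : ℤ) • e.kolyvaginClass Nat.prime_two L ≠ 0 by
    obtain ⟨n, e, hn, hcard, hq, hne⟩ := h
    exact ⟨n, e, hn, hcard, hq, hne, not_pow_dvd_derivedPoint_of_zsmul_kolyvaginClass_ne_zero W e hL hne⟩
  induction r with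
  | zero =>
    -- `n = 1`: `c_L(1)` has order exactly `2^{L−M₀}`
    have h4 : NumberField.discr K ≠ -4 := fun h ↦ by
      rw [h] at hodd
      exact (Int.not_even_iff_odd.mpr hodd) ⟨-2, by norm_num⟩
    have hD : NumberField.discr K < -4 := X11b.KolyvaginAssembly.discr_lt_neg_four hK ⟨h3, h4⟩
    have hsurj1 : W.HasSurjectiveModNGaloisRep ((2 : ℤ) ^ 1) := by simpa using hρ2
    have hND : IsCoprime ((W.conductorNorm ℤ : ℕ) : ℤ) (NumberField.discr K) :=
      GenusKoly.heegner_isCoprime_conductorNorm_discr hK hHe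
    have hM₀L : M₀ ≤ L := by omega
    have hn1 : Squarefree 1 := squarefree_one
    have hkol1 : ∀ q ∈ (1 : ℕ).primeFactors,
        Zhang2014.IsKolyvaginPrime (W.conductorNorm ℤ) W K 2 q ∧ L ≤ Zhang2014.kolyvaginIndex W 2 q := by
      intro q hq
      simp at hq
    let data₁ : (m : ℕ) → m ∣ 1 → KolyvaginHeegnerData Dt β ι m := fun m hm ↦ (Nat.dvd_one.mp hm).symm ▸ d₁
    have hdata₁ : data₁ 1 dvd_rfl = d₁ := rfl
    have hA : KolyvaginCocycle.IsAdmissible (absoluteGaloisGroup K) d₁.pointsSubgroup ((2 ^ L : ℕ) : ℤ) :=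
      GenusKoly.isAdmissible_pointsSubgroup_two hK hodd hHe hsurj1 one_ne_zero d₁ L
    have hP : d₁.toGeomPoints d₁.derivedPoint ∈
        KolyvaginCocycle.invPoints (absoluteGaloisGroup K) d₁.pointsSubgroup ((2 ^ L : ℕ) : ℤ) := by
      have h := Rank1Residual.X11b.Three.KolyCert.toGeomPoints_derivedPoint_mem_invPoints_of_dvd_zhang hK ι Dt
        Nat.prime_two hND hD hn1 hkol1 data₁ 1 dvd_rfl
      rwa [hdata₁] at h
    have hXord : addOrderOf (d₁.kolyvaginClass Nat.prime_two L) = 2 ^ (L - M₀) :=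
      Rank1Residual.JET.addOrderOf_kolyvaginClass_of_exactDepth d₁ Nat.prime_two hM₀L hA hP hdiv hndiv
    refine ⟨1, d₁, hn1, by simp, fun q hq ↦ by simp at hq, ?_⟩
    intro h0
    have hdvd : addOrderOf (d₁.kolyvaginClass Nat.prime_two L) ∣ 2 ^ (L - M₀ - 1) := by
      rw [addOrderOf_dvd_iff_nsmul_eq_zero, ← natCast_zsmul]
      exact h0
    rw [hXord] at hdvd
    have := Nat.le_of_dvd (pow_pos two_pos _) hdvd
    have hlt : 2 ^ (L - M₀ - 1) < 2 ^ (L - M₀) := Nat.pow_lt_pow_right (by norm_num) (by omega)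
    omega
  | succ r ih =>
    obtain ⟨n, e, hn, hcard, hq, hne⟩ := ih
    obtain ⟨ℓ, e', hℓp, -, hℓn, hKol, hidx, hFrob, hF, hne'⟩ :=
      exists_deep_mul_depth_le W hCM hin hρ2 hK hodd h3 hHe h37 Dt β ι hL hn (fun q hq' ↦ ⟨(hq q hq').1, (hq q hq').2.1⟩)
        e hne ∅
    have hn0 : n ≠ 0 := hn.ne_zero
    have hℓdvd : ¬ ℓ ∣ n := fun h ↦ hℓn (Nat.mem_primeFactors.mpr ⟨hℓp, h, hn0⟩)
    have hsq : Squarefree (n * ℓ) :=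
      (Nat.squarefree_mul ((Nat.Prime.coprime_iff_not_dvd hℓp).mpr hℓdvd).symm).mpr ⟨hn, hℓp.squarefree⟩
    refine ⟨n * ℓ, e', hsq, ?_, ?_, hne'⟩
    · rw [Nat.primeFactors_mul hn0 hℓp.ne_zero, hℓp.primeFactors, Finset.card_union_of_disjoint
        (Finset.disjoint_singleton_right.mpr hℓn), hcard, Finset.card_singleton]
    · intro q hq'
      rw [Nat.primeFactors_mul hn0 hℓp.ne_zero, Finset.mem_union] at hq'
      rcases hq' with hq' | hq'
      · exact hq q hq'
      · rw [hℓp.primeFactors, Finset.mem_singleton] at hq'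
        subst hq'
        exact ⟨hKol, hidx, hFrob, hF⟩

/-! ## §2 The stub's own currency: `y_K` of infinite order and `2`-divisible -/

omit [W.IsGloballyMinimal] in
/-- **Exact positive depth from the stub's two hypotheses.**  `K` imaginary quadratic, a frame `(Dt, β, ι)` and
a conductor-`1` datum `d₁` with `y_K = P(1)` of infinite order and `2 ∣ y_K` in `E(K[1])`: there is `M₀ ≥ 1`
with `2^{M₀} ∣ y_K` and `2^{M₀+1} ∤ y_K` (Mordell–Weil over the number field `K[1]`; McCallum 1991 §5,
`ord_2(P₁)` is attained). [cite: McCallumLMS1991, §5 (ord_p(P_n), p. 303)] [cite: SilvermanAEC2009, Thm. VIII.6.7] -/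
theorem exists_exactDepth_pos (hK : IsImaginaryQuadratic K)
    (Dt : ModularParametrizationData W (W.conductorNorm ℤ)) (β : ℤ) (ι : K →+* ℂ)
    (d₁ : KolyvaginHeegnerData Dt β ι 1) (hy : ¬ IsOfFinAddOrder d₁.derivedPoint)
    (hpos : ∃ Q : (W.baseChange (ringClassField K ι 1)).toAffine.Point, (2 : ℤ) • Q = d₁.derivedPoint) :
    ∃ M₀ : ℕ, 1 ≤ M₀ ∧
      (∃ Q : (W.baseChange (ringClassField K ι 1)).toAffine.Point, ((2 ^ M₀ : ℕ) : ℤ) • Q = d₁.derivedPoint) ∧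
      ¬ ∃ Q : (W.baseChange (ringClassField K ι 1)).toAffine.Point,
        ((2 ^ (M₀ + 1) : ℕ) : ℤ) • Q = d₁.derivedPoint := by
  haveI : NumberField (ringClassField K ι 1) := numberField_ringClassField hK ι one_ne_zero
  haveI : (W.baseChange (ringClassField K ι 1)).IsElliptic := by rw [baseChange]; infer_instance
  haveI : Module.Finite ℤ (W.baseChange (ringClassField K ι 1)).toAffine.Point := by
    convert (W.baseChange (ringClassField K ι 1)).module_finite_point_holds
  obtain ⟨M₀, hdiv, hndiv⟩ := exists_pow_smul_eq_and_not_of_not_isOfFinAddOrder Nat.prime_two hy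
  refine ⟨M₀, ?_, hdiv, hndiv⟩
  by_contra h0
  have hM : M₀ = 0 := by omega
  subst hM
  exact hndiv (by simpa using hpos)

/-- **THE FIRST DESCENT STEP IN THE STUB'S CURRENCY.**  On an H₂ frame (`W` globally minimal with CM, `2` inert in
the CM field, `ρ̄_{E,2}` onto; `K` imaginary quadratic, odd `d_K ≠ −3`, Heegner; Gross 1991 Prop. 3.7 (2) at
`(W, K)` by name) with a conductor-`1` datum `d₁` such that `y_K = P(1)` has infinite order and is `2`-divisible in
`E(K[1])` — the hypotheses of `stub_positiveDepth` — and for every finite `S`: there are an exact depth `M₀ ≥ 1`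
(`2^{M₀} ∥ y_K`), a prime `ℓ ∉ S` that is Zhang–Kolyvagin at `2` of index `≥ M₀ + 1` with `Frob_ℓ = Frob_∞` on
`K(E[2^{M₀+1}])` and `CMInert W ℓ`, and a datum `e` of conductor `ℓ` with `2^{M₀+1} ∤ P(ℓ)` in `E(K[ℓ])`
(`m(ℓ) ≤ m(1) = M₀`: the `2`-divisibility depth does not grow at the first deep CM-inert prime).
[cite: Kolyvagin1991MathAnn, Thm. 2.2] [cite: McCallumLMS1991, §5 proof of Prop. 5.2] [cite: GrossLMS1991, Prop. 3.7 (2)] -/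
theorem exists_exactDepth_and_deep_cmInert_prime (hCM : W.HasCM) (hin : Rank1Residual.CMInert W 2)
    (hρ2 : W.HasSurjectiveModNGaloisRep 2)
    (hK : IsImaginaryQuadratic K) (hodd : Odd (NumberField.discr K)) (h3 : NumberField.discr K ≠ -3)
    (hHe : SatisfiesHeegnerHypothesis (W.conductorNorm ℤ) K)
    (h37 : prop37_2_reductionCongruence_inert (W.conductorNorm ℤ) W K)
    (Dt : ModularParametrizationData W (W.conductorNorm ℤ)) (β : ℤ) (ι : K →+* ℂ)
    (d₁ : KolyvaginHeegnerData Dt β ι 1) (hy : ¬ IsOfFinAddOrder d₁.derivedPoint)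
    (hpos : ∃ Q : (W.baseChange (ringClassField K ι 1)).toAffine.Point, (2 : ℤ) • Q = d₁.derivedPoint)
    (S : Finset ℕ) :
    ∃ M₀ : ℕ, 1 ≤ M₀ ∧
      (∃ Q : (W.baseChange (ringClassField K ι 1)).toAffine.Point, ((2 ^ M₀ : ℕ) : ℤ) • Q = d₁.derivedPoint) ∧
      (¬ ∃ Q : (W.baseChange (ringClassField K ι 1)).toAffine.Point,
        ((2 ^ (M₀ + 1) : ℕ) : ℤ) • Q = d₁.derivedPoint) ∧
      ∃ (ℓ : ℕ) (e : KolyvaginHeegnerData Dt β ι ℓ), ℓ.Prime ∧ ℓ ∉ S ∧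
        Zhang2014.IsKolyvaginPrime (W.conductorNorm ℤ) W K 2 ℓ ∧ M₀ + 1 ≤ Zhang2014.kolyvaginIndex W 2 ℓ ∧
        FrobEqFrobInfty W K (2 ^ (M₀ + 1)) ℓ ∧ Rank1Residual.CMInert W ℓ ∧
        ¬ ∃ Q : (W.baseChange (ringClassField K ι ℓ)).toAffine.Point,
          ((2 ^ (M₀ + 1) : ℕ) : ℤ) • Q = e.derivedPoint := by
  obtain ⟨M₀, hM₀, hdiv, hndiv⟩ := exists_exactDepth_pos W hK Dt β ι d₁ hy hpos
  obtain ⟨ℓ, e, hℓp, hℓS, hKol, hidx, hFrob, hF, he⟩ :=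
    exists_deep_cmInert_prime_depth_le W hCM hin hρ2 hK hodd h3 hHe h37 Dt β ι d₁ hdiv hndiv (L := M₀ + 1) le_rfl S
  exact ⟨M₀, hM₀, hdiv, hndiv, ℓ, e, hℓp, hℓS, hKol, hidx, hFrob, hF, he⟩

/-- **The stub's currency, every number of prime factors.**  Same frame and hypotheses as
`exists_exactDepth_and_deep_cmInert_prime`; for every `r` there are an exact depth `M₀ ≥ 1` of `y_K`, a square-free
`n` with exactly `r` prime factors (each Zhang–Kolyvagin at `2` of index `≥ M₀ + 1`, `Frob = Frob_∞` on
`K(E[2^{M₀+1}])`, inert in the CM field) and a datum `e` of conductor `n` with `2^{M₀+1} ∤ P(n)` in `E(K[n])`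
(`m_r ≤ m_0 = M₀`). [cite: McCallumLMS1991, §5 (m_r; proof of Prop. 5.2)] [cite: Kolyvagin1991MathAnn, Thm. 2.2] -/
theorem exists_exactDepth_and_squarefree_card (hCM : W.HasCM) (hin : Rank1Residual.CMInert W 2)
    (hρ2 : W.HasSurjectiveModNGaloisRep 2)
    (hK : IsImaginaryQuadratic K) (hodd : Odd (NumberField.discr K)) (h3 : NumberField.discr K ≠ -3)
    (hHe : SatisfiesHeegnerHypothesis (W.conductorNorm ℤ) K)
    (h37 : prop37_2_reductionCongruence_inert (W.conductorNorm ℤ) W K)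
    (Dt : ModularParametrizationData W (W.conductorNorm ℤ)) (β : ℤ) (ι : K →+* ℂ)
    (d₁ : KolyvaginHeegnerData Dt β ι 1) (hy : ¬ IsOfFinAddOrder d₁.derivedPoint)
    (hpos : ∃ Q : (W.baseChange (ringClassField K ι 1)).toAffine.Point, (2 : ℤ) • Q = d₁.derivedPoint)
    (r : ℕ) :
    ∃ M₀ : ℕ, 1 ≤ M₀ ∧
      (∃ Q : (W.baseChange (ringClassField K ι 1)).toAffine.Point, ((2 ^ M₀ : ℕ) : ℤ) • Q = d₁.derivedPoint) ∧
      (¬ ∃ Q : (W.baseChange (ringClassField K ι 1)).toAffine.Point,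
        ((2 ^ (M₀ + 1) : ℕ) : ℤ) • Q = d₁.derivedPoint) ∧
      ∃ (n : ℕ) (e : KolyvaginHeegnerData Dt β ι n), Squarefree n ∧ n.primeFactors.card = r ∧
        (∀ q ∈ n.primeFactors, Zhang2014.IsKolyvaginPrime (W.conductorNorm ℤ) W K 2 q ∧
          M₀ + 1 ≤ Zhang2014.kolyvaginIndex W 2 q ∧ FrobEqFrobInfty W K (2 ^ (M₀ + 1)) q ∧
          Rank1Residual.CMInert W q) ∧
        ¬ ∃ Q : (W.baseChange (ringClassField K ι n)).toAffine.Point,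
          ((2 ^ (M₀ + 1) : ℕ) : ℤ) • Q = e.derivedPoint := by
  obtain ⟨M₀, hM₀, hdiv, hndiv⟩ := exists_exactDepth_pos W hK Dt β ι d₁ hy hpos
  obtain ⟨n, e, hn, hcard, hq, -, he⟩ :=
    exists_squarefree_card_depth_le W hCM hin hρ2 hK hodd h3 hHe h37 Dt β ι d₁ hdiv hndiv (L := M₀ + 1) le_rfl r
  exact ⟨M₀, hM₀, hdiv, hndiv, n, e, hn, hcard, hq, he⟩

end Summit.BirchSwinnertonDyer.BirchSwinnertonDyer.Theorems.CMKolyvaginFirstDescentTwo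

end
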